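import Literature.NumberTheory.Transcendental.RoySmallValueSelectionLemma
import Literature.NumberTheory.Transcendental.RoySmallValueOrbitsK
import HarnessLib

/-!
# Roy's small value estimate for `𝔾ₐ × 𝔾ₘ` — selecting a Galois orbit of `𝒵(P̃, Q)` on which all small forms are small

Topic `Literature/NumberTheory/Transcendental`. Part of the formalisation of the proof of Roy 2013,
Theorem 1.1 (named fact `roy2013_thm_1_1`, `RoySmallValueEstimates.lean`), seat B. Source: D. Roy,
*A small value estimate for `𝔾ₐ × 𝔾ₘ`*, Mathematika 59 (2013) 333–363 = arXiv:1301.0663, §6,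
proof of Proposition 6.2 and Proposition 6.4 (pp. 16–17 of the arXiv text):

> [...] we can write `W = m₁Z₁ + ⋯ + m_sZ_s` where `Z₁, …, Z_s` are distinct irreducible curves
> [...] we deduce that there is at least one index `i` such that [...]
> **Proposition 6.4.** [...] Then there is a zero-dimensional subvariety of `ℙ²_ℚ` contained in
> `𝒵(𝒟ⁱP ; 0 ≤ i < 2T)` with `h_𝒞(Z) ≤ −C''(Y deg(Z) + D h(Z))`.

In this development the subvariety `Z` is selected among the Galois ORBITS of the normalised
representatives of `𝒵(P̃, Q)(ℂ)` by the abstract selection lemma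
`exists_component_forall_prod_le` (`RoySmallValueSelectionLemma`): if every admissible family of
tests `(t_j)` satisfies `∏_j v_j(t_j)^{e_j} ≤ ε` and the weights satisfy `∑_O e_O w_O ≤ B` (the
multiplicity `e` being constant on orbits), some orbit `O` has `∏_{j∈O} v_j(t_j) ≤ ε^{w_O/B}` for
EVERY admissible family. This file performs the bookkeeping from "components" to orbits:

* `exists_orb_forall_prod_le` — the selection for an abstract orbit map `orb : ι → Finset ι`
  (a partition: `j ∈ orb j`, `i ∈ orb j → orb i = orb j`) and exponents constant on orbits;
* `ZeroConfigK.orb_eq_of_mem` — the orbits of `RoySmallValueOrbitsK` form such a partition, and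
  `ZeroConfigK.exists_orb_forall_prod_le` — the selection of an orbit of `𝒵(P, Q)`.

Everything is proved; no definitions, no named facts.

## References

* [Roy2013] D. Roy, *A small value estimate for 𝔾ₐ × 𝔾ₘ*, Mathematika 59 (2013), 333–363
  (arXiv:1301.0663), §6, proofs of Propositions 6.2 and 6.4.
-/

noncomputable section

open Finset

namespace Literature.NumberTheory.Transcendental

namespace Roy2013

/-! ### Selection of an orbit of an abstract partition -/

/-- **Selection of an orbit.** `orb : ι → Finset ι` is a partition of the finite index set into
"orbits" (`j ∈ orb j`, and `i ∈ orb j → orb i = orb j`), `e` is constant on orbits with values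
`≥ 1` (`eO O` its value on the orbit `O`), `w` a weight on orbits with `∑_O e_O w_O ≤ B`. If every
admissible family of tests satisfies `∏_j v_j(t_j)^{e_j} ≤ ε` (`0 < ε < 1`), then for some `j₀`
and EVERY family admissible on `orb j₀`: `∏_{j ∈ orb j₀} v_j(t_j) ≤ ε^{w(orb j₀)/B}`.
[cite: Roy2013, §6, proof of Prop. 6.2 (choice of the index `i`) and Prop. 6.4 (choice of `Z`)] -/
theorem exists_orb_forall_prod_le {ι X : Type*} [Fintype ι] [DecidableEq ι] (orb : ι → Finset ι)
    (hself : ∀ j, j ∈ orb j) (horb : ∀ i j, i ∈ orb j → orb i = orb j) (e : ι → ℕ)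
    (eO : Finset ι → ℕ) (heO : ∀ j, eO (orb j) = e j) (he1 : ∀ j, 1 ≤ e j) (w : Finset ι → ℝ)
    (ok : X → Prop) (v : ι → X → ℝ) {ε B : ℝ} (hε0 : 0 < ε) (hε1 : ε < 1) (hB : 0 < B)
    (hsum : ∑ O ∈ univ.image orb, (eO O : ℝ) * w O ≤ B)
    (H : ∀ t : ι → X, (∀ j, ok (t j)) → ∏ j, v j (t j) ^ e j ≤ ε) :
    ∃ j₀, ∀ t : ι → X, (∀ j ∈ orb j₀, ok (t j)) →
      ∏ j ∈ orb j₀, v j (t j) ≤ ε ^ (w (orb j₀) / B) := by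
  classical
  -- the type of orbits and the component map
  obtain ⟨comp, hcomp⟩ : ∃ comp : ι → ↥(univ.image orb),
      comp = fun j => ⟨orb j, mem_image.mpr ⟨j, mem_univ _, rfl⟩⟩ := ⟨_, rfl⟩
  have hsum' : ∑ O : ↥(univ.image orb), (eO O.1 : ℝ) * w O.1 ≤ B := by
    rw [Finset.sum_coe_sort (univ.image orb) (fun O => (eO O : ℝ) * w O)]
    exact hsum
  have he' : ∀ O : ↥(univ.image orb), 1 ≤ eO O.1 := by
    intro O
    obtain ⟨j, -, hj⟩ := mem_image.mp O.2
    rw [← hj, heO]; exact he1 j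
  have H' : ∀ t : ι → X, (∀ j, ok (t j)) → ∏ j, v j (t j) ^ eO (comp j).1 ≤ ε := by
    intro t ht
    have : ∀ j, eO (comp j).1 = e j := fun j => by rw [hcomp]; exact heO j
    simp only [this]
    exact H t ht
  obtain ⟨O, hO⟩ := exists_component_forall_prod_le comp (fun O => eO O.1) he' (fun O => w O.1)
    ok v hε0 hε1 hB hsum' H'
  obtain ⟨j₀, -, hj₀⟩ := mem_image.mp O.2
  -- the fibre of `comp` over `O` is `orb j₀`
  have hfib : univ.filter (fun j => comp j = O) = orb j₀ := by
    ext j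
    simp only [mem_filter, mem_univ, true_and]
    constructor
    · intro h
      have h1 : orb j = orb j₀ := by
        have := congrArg Subtype.val h
        simp only [hcomp] at this
        rw [this, hj₀]
      rw [← h1]; exact hself j
    · intro h
      apply Subtype.ext
      simp only [hcomp]
      rw [horb j j₀ h, hj₀]
  refine ⟨j₀, fun t ht => ?_⟩
  have hO' := hO t (fun j hj => ht j (by
    have : j ∈ univ.filter (fun j => comp j = O) := mem_filter.mpr ⟨mem_univ _, hj⟩
    rwa [hfib] at this))
  rw [hfib] at hO'
  have hw : w O.1 = w (orb j₀) := by rw [← hj₀]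
  rw [hw] at hO'
  exact hO'

/-! ### The orbits of `𝒵(P, Q)` -/

namespace ZeroConfigK

variable {K : IntermediateField ℚ ℂ} {ι : Type*} [Fintype ι] [DecidableEq ι] (Z : ZeroConfigK K ι)
  [NumberField K]

/-- **Orbits form a partition**: `i ∈ orb i₀ → orb i = orb i₀`. [folklore] -/
theorem orb_eq_of_mem {i₀ i : ι} (hi : i ∈ Z.orb i₀) : Z.orb i = Z.orb i₀ := by
  obtain ⟨-, g, rfl⟩ := mem_filter.mp hi
  ext j
  simp only [ZeroConfigK.orb, mem_filter, mem_univ, true_and]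
  constructor
  · rintro ⟨h, rfl⟩
    exact ⟨h * g, Z.perm_mul h g i₀⟩
  · rintro ⟨h, rfl⟩
    refine ⟨h * g⁻¹, ?_⟩
    rw [Z.perm_mul, ← Z.perm_mul g⁻¹ g, inv_mul_cancel, Z.perm_one]

/-- **Selection of a Galois orbit of `𝒵(P, Q)`** on which every admissible family of tests is
small (the zero-dimensional `Z ⊆ 𝒵(P, Q)` of Prop. 6.4, found among the `ℚ`-irreducible
components = orbits). [cite: Roy2013, §6, Prop. 6.4 and its proof] -/
theorem exists_orb_forall_prod_le {X : Type*} (e : ι → ℕ) (eO : Finset ι → ℕ)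
    (heO : ∀ j, eO (Z.orb j) = e j) (he1 : ∀ j, 1 ≤ e j) (w : Finset ι → ℝ) (ok : X → Prop)
    (v : ι → X → ℝ) {ε B : ℝ} (hε0 : 0 < ε) (hε1 : ε < 1) (hB : 0 < B)
    (hsum : ∑ O ∈ univ.image Z.orb, (eO O : ℝ) * w O ≤ B)
    (H : ∀ t : ι → X, (∀ j, ok (t j)) → ∏ j, v j (t j) ^ e j ≤ ε) :
    ∃ j₀, ∀ t : ι → X, (∀ j ∈ Z.orb j₀, ok (t j)) →
      ∏ j ∈ Z.orb j₀, v j (t j) ≤ ε ^ (w (Z.orb j₀) / B) :=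
  Roy2013.exists_orb_forall_prod_le Z.orb (fun j => Z.self_mem_orb j)
    (fun _ _ h => Z.orb_eq_of_mem h) e eO heO he1 w ok v hε0 hε1 hB hsum H

end ZeroConfigK

end Roy2013

end Literature.NumberTheory.Transcendental
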